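/-
Copyright (c) 2026 the pub-hodgecm-mathlib formalisation cell (harness21).  Prover seat hodgecm-mathlib-K2E3-p23 (g9), Track B «K2-LIT» ∕ hLiu418 #184♮,
Road I v3, unit U5 «THE CLOSE», FACE-D₀ row `hfin₂` ∕ route (B3) «global unfolding», brick B3-2c-op (FACE-D₀ desk K2Liu-p02 (g10) DESK WORD #7): THE GLOBAL
MULTIPLIER LAW IN THE κ-MODEL — on ALL of `N_Δ(𝔸)` (archimedean part NOT killed), on EVERY `Ψ ∈ 𝒮(𝔸^{n″})` (no pure tensors).  THEOREMS ONLY.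
-/
import Summits.HodgeConjecture.HodgeConjecture.Theorems.K2LiuLinePairKappaModelLetter          -- K2Liu-p02 ★ p863896 (brings ★ FILE 3 `K2LiuLinePairKappaModelOnUnipotents`, ★ p863642, ★ p863400, ★ D8)
import Summits.HodgeConjecture.HodgeConjecture.Theorems.K2LiuLinePairCayleySiegelUnipotent     -- F0P2-p10 ★ p863869 FILE 2c: `ratSp_lineCayleyMover_conj_toSp_mem_siegelParabolicPi`, `aMat_cMat_lineKappa_of_mem_unipDelta`
import HarnessLib

/-!
# K2_Liu road (hLiu418 = stmt-HodgeConjecture-24832), FACE-D₀ route (B3), brick B3-2c-op: THE κ-MODEL MULTIPLIER LAW ON ALL OF `N_Δ(𝔸)`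

Cell `pub/hodgecm-mathlib` (D-0151), Track B, build stream 29; helper lane `--supports stmt-HodgeConjecture-24832 --as helper`, count-neutral.

★ FILE 3 `K2LiuLinePairKappaModelOnUnipotents.kappaModel_tmul_of_mem_unipDelta` ∕ `pairRep_line_kappaModel_tmul` read the κ-model `Tg := M_q⁻¹` of the line pair's Weil
representation on PURE TENSORS for unipotents whose chirp parameter has ZERO archimedean part (the finite-place organ of the `h2₂`∕`hloc₂` rows).  The GLOBAL UNFOLDING of
the theta side (route (B3): `Θ` read at rational points, desk K2Liu-p02 (g10) WORDS #4–#7, K2E3-p37 (g4)'s B3-2b) wants the same law on ALL of `N_Δ(𝔸)` and on every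
`Ψ`: THIS FILE is ★ p863642 `omega_eq_conj_siegelLift_of_mem_unipDelta` ∘ ★ `toOp_adelicSiegelLift_eq_chirpLM` WITHOUT the last two steps of ★ FILE 3 (`S_∞ = 0`,
`chirpLM_tmul_of_archPart_eq_zero`):
* §1 (generic `s : H(𝔸) →* Mp_ψ(𝕎_𝔸)ᶜᵒⁿᵗ`, `g`, lift `q`) **`kappaModel_eq_chirpLM_of_mem_unipDelta`** — `M_q⁻¹ (ω(s u) (M_q Ψ)) = t(−½ c_{p_u}) Ψ`, `p_u := g⁻¹ π(s u) g`,
  for `u ∈ N_Δ(𝔸)` with Levi reading `a_{p_u}⁻¹ = 1` (`t(S) = chirpLM S`: `(t(S)Φ)(x) = ψ_𝔸(xᵀ S x) Φ(x)`, ★ `coe_chirpLM`);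
* §2 (the LINE PAIR of ★ D8) **`pairRep_line_kappaModel_eq_chirpLM`** — the same for `ω = pairRep … (chiSplittingLine …)` at `(toDiagA u, 1)`, membership `hj` in FILE 2's currency;
* §3 (AT THE LINE CAYLEY MOVER OF RECORD `κ_n`, F0P2-p10 ★ FILE 2/2c; `g := (ratSp κ_n)⁻¹`, `q := r_F(κ_n)⁻¹`, so `Tg = M_q⁻¹ = ω(r_F κ_n)`):
  **`pairRep_line_lineCayley_eq_chirpLM`** — NO letters left: `Tg (ω(toDiagA u, 1) (Tg⁻¹ Ψ)) = t((−½) • c_{q_u}) Ψ` for every `u ∈ N_Δ(𝔸)`, `Ψ`, with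
  `q_u := ratSp κ_n · ι(u ⊗ 1) · (ratSp κ_n)⁻¹` (membership ★ `ratSp_lineCayleyMover_conj_toSp_mem_siegelParabolicPi`, Levi reading ★ `aMat_cMat_lineKappa_of_mem_unipDelta`.1);
  **`pairRep_line_lineCayley_eq_chirpLM_closedForm`** — the same with `c_{q_u}` in ★ p863869's CLOSED FORM `1ᵀ · reindex (a′ • J₂ · Res(−X_u − X_u) · D₂(⅟2))` (the bytes
  K2E3-p23 (g8)'s S-letters organ reads at a finite place; B3-2c-idx (desk) keys its index map `Q` to them);
  **`thetaDist_lineCayleyTg`** — `Θ (Tg Ψ) = Θ Ψ` (★ `thetaDist_omega_ratThetaLiftCont`: `r_F` fixes `Θ`) — B3-2b's `hΘ` BY NAME.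
No definition, no instance, no notation, no named-fact hypothesis, no `sorry`; axioms ⊆ {propext, Classical.choice, Quot.sound}.  HONEST LABEL: HC_CM is proved only modulo
the 7 printed citations (2 remaining named inputs: hLiu418 = stmt-HodgeConjecture-24832, h413 = stmt-HodgeConjecture-24833) until rung 0 closes; this file moves no counter
(`hsign₂′` waits on B3-2a∕b∕c-idx and the tie).
References: [Weil1964] A. Weil, Acta Math. 111 (1964), Chap. I n° 13 p. 160 (`𝐫₀ = t₀ d₀`), n° 34 p. 184 (`t(f)`), Chap. III n° 36–41 pp. 187–193 (`r_F`, `Θ`-invariance);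
[Kudla1994] S. S. Kudla, Israel J. Math. 87 (1994), §3; [Kudla1996] Chap. I §2 Prop. 2.3; [MoeglinVignerasWaldspurger1987] LNM 1291, Chap. 2 II.1 (B), II.2;
[GelbartRogawski1991] §3.1 Prop. 3.1.1 p. 455; [Liu2021] App. B Prop. B.8 p. 104, App. D §D.1 Step 2.
-/

set_option autoImplicit false
set_option linter.dupNamespace false
-- the line-pair carriers elaborate to very large types; elaborate sequentially (as in ★ `K2LiuFirstTermLineLiftRankRowModelConj`)
set_option Elab.async false

noncomputable section

open NumberField NumberField.mixedEmbedding IsDedekindDomain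
open scoped Matrix TensorProduct SchwartzMap Classical  -- `Classical`: the `Fintype` of real ∕ complex places inside `mixedSpace` (as ★ p863332, ★ p863400)

namespace Summit.HodgeConjecture.HodgeConjecture.Cruxes.HLiu418.K2LiuLinePairKappaModelChirpGlobal


open Literature.NumberTheory.Automorphic Literature.NumberTheory.Automorphic.UnitaryGroup Literature.NumberTheory.GaloisRepresentations
open Literature.NumberTheory.Automorphic.IdeleClassGroup
open Literature.NumberTheory.Automorphic.Liu2021 Literature.NumberTheory.Automorphic.Liu2021.Def411WeilCarriers
open Literature.NumberTheory.Automorphic.Liu2021.Def411WeilCarriersDoubling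
open Literature.RepresentationTheory.HeisenbergGroup Literature.RepresentationTheory.Liu2021
open Literature.NumberTheory.GelbartRogawski1991 Literature.NumberTheory.GelbartRogawski1991.UnitaryDualPair
open Literature.NumberTheory.GelbartRogawski1991.GRConstruction
open Literature.NumberTheory.K2Lit.SiegelDoubled Literature.NumberTheory.K2Lit.DoubledLineTheta
open Literature.NumberTheory.Weil1964
open Summit.HodgeConjecture.HodgeConjecture.Cruxes.HLiu418.K2LiuMetaplecticUnipotentRigidity (eq_on_unipDelta_of_proj_eq omega_eq_conj_siegelLift_of_mem_unipDelta)
open Summit.HodgeConjecture.HodgeConjecture.Cruxes.HLiu418.K2LiuLinePairKappaModelOnUnipotents (toOp_adelicSiegelLift_eq_chirpLM proj_pairSplitting_line)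
open Summit.HodgeConjecture.HodgeConjecture.Cruxes.HLiu418.K2LiuLinePairCayleySiegel (lineCayleyMover_mem_symplecticGroup)
open Summit.HodgeConjecture.HodgeConjecture.Cruxes.HLiu418.K2LiuLinePairCayleySiegelUnipotent (ratSp_lineCayleyMover_conj_toSp_mem_siegelParabolicPi aMat_cMat_lineKappa_of_mem_unipDelta)
open Summit.HodgeConjecture.HodgeConjecture.Cruxes.HLiu418.K2LiuLinePairKappaModelLetter (aInvMat_eq_one_of_aMat_eq_one)

variable (L : Type) [Field L] [NumberField L] [IsCMField L]
variable {N M n : ℕ} (e : Fin N × Fin M ≃ Fin n)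
  (dV : Fin N → L) (hdV : ∀ i, IsCMField.complexConj L (dV i) = dV i)
  (dW : Fin M → L) (hdW : ∀ i, IsCMField.complexConj L (dW i) = dW i)
/-! ## §1 Generic: the κ-model of ANY homomorphism `s : H(𝔸) →* Mp_ψ(𝕎_𝔸)ᶜᵒⁿᵗ`, on every `Ψ`, from the Levi reading alone -/

section Generic

variable {F : Type} [Field F] [NumberField F] {m : ℕ} {TA : Matrix (Fin m) (Fin m) (AdeleRing (𝓞 F) F)}

/-- **THE κ-MODEL MULTIPLIER LAW, GENERIC, ALL OF `N_Δ(𝔸)`.**  `s : H(𝔸) →* Mp_ψ(𝕎_𝔸)ᶜᵒⁿᵗ` any homomorphism whose symplectic image of `P_Δ(𝔸)` lies in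
`g P_𝕐(𝔸) g⁻¹`, `q` a lift of `g`, `u ∈ N_Δ(𝔸)` with Levi reading `a_{p_u}⁻¹ = 1` (`p_u := g⁻¹ π(s u) g`).  Then in the model `Tg := M_q⁻¹` the operator `ω(s u)` IS
the chirp `t(−½ c_{p_u})` on EVERY `Ψ` — ★ p863642 `omega_eq_conj_siegelLift_of_mem_unipDelta` (`ω(s u) = M_q M_{𝐫₀ p_u} M_q⁻¹`, scalar-exact) ∘ ★
`toOp_adelicSiegelLift_eq_chirpLM`.  (★ FILE 3's pure-tensor head is this followed by `chirpLM_tmul_of_archPart_eq_zero` when `(c_{p_u})_∞ = 0`.)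
[cite: Weil1964, Chap. I n° 13 p. 160, n° 34 p. 184] [cite: Kudla1994, §3] [cite: MoeglinVignerasWaldspurger1987, Chap. 2 II.1 (B)] -/
theorem kappaModel_eq_chirpLM_of_mem_unipDelta (hdV0 : ∀ i, dV i ≠ 0) (hdW0 : ∀ i, dW i ≠ 0) (hT : IsUnit TA.det)
    (s : HA L e dV hdV dW hdW →* adelicMpCont F (Fin m) TA) (g : symplecticGroup (polar (adelicForm F (Fin m) TA)))
    (q : adelicMp F (Fin m) TA) (hqc : q ∈ adelicMpCont F (Fin m) TA) (hq : MpPsi.proj _ q = g)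
    (hj : ∀ p : ↥(siegelDelta L e dV hdV dW hdW),
      g⁻¹ * ((adelicMpCont.proj F (Fin m) TA).comp (s.comp (siegelDelta L e dV hdV dW hdW).subtype)) p * g ∈ siegelParabolicPi TA)
    {u : HA L e dV hdV dW hdW} (hu : u ∈ unipDelta L e dV hdV dW hdW)
    (ha : SiegelParabolicPi.aInvMat (g⁻¹ * adelicMpCont.proj F (Fin m) TA (s u) * g) = 1)
    {S : Matrix (Fin m) (Fin m) (AdeleRing (𝓞 F) F)}
    (hS : (-⅟(2 : AdeleRing (𝓞 F) F)) • SiegelParabolicPi.cMat (g⁻¹ * adelicMpCont.proj F (Fin m) TA (s u) * g) = S)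
    (Ψ : piSchwartzBruhat F (Fin m)) :
    (MpPsi.toOp (adelicSchrodinger F (Fin m) TA) q).symm
        (adelicMpCont.omega F (Fin m) TA (s u) (MpPsi.toOp (adelicSchrodinger F (Fin m) TA) q Ψ)) = chirpLM F S Ψ := by
  have h1 := omega_eq_conj_siegelLift_of_mem_unipDelta L e dV hdV dW hdW hdV0 hdW0 hT s g q hqc hq hj hu
    (MpPsi.toOp (adelicSchrodinger F (Fin m) TA) q Ψ)
  have h2 : (MpPsi.toOp (adelicSchrodinger F (Fin m) TA) q)⁻¹
      (MpPsi.toOp (adelicSchrodinger F (Fin m) TA) q Ψ) =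
        Ψ :=
    (MpPsi.toOp (adelicSchrodinger F (Fin m) TA) q).symm_apply_apply _
  have h3 := toOp_adelicSiegelLift_eq_chirpLM hT
    ⟨g⁻¹ * adelicMpCont.proj F (Fin m) TA (s u) * g, hj ⟨u, unipDelta_le_siegelDelta L e dV hdV dW hdW hu⟩⟩ ha
    Ψ
  exact (congrArg (MpPsi.toOp (adelicSchrodinger F (Fin m) TA) q).symm h1).trans <|
    ((MpPsi.toOp (adelicSchrodinger F (Fin m) TA) q).symm_apply_apply _).trans <|
      (congrArg (MpPsi.toOp (adelicSchrodinger F (Fin m) TA) (adelicSiegelLift F TA hT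
        ⟨g⁻¹ * adelicMpCont.proj F (Fin m) TA (s u) * g, hj ⟨u, unipDelta_le_siegelDelta L e dV hdV dW hdW hu⟩⟩)) h2).trans <|
        h3.trans (congrArg (fun S' => chirpLM F S' Ψ) hS)

end Generic

/-! ## §2 The LINE PAIR `(U(𝔻), U(⟨a′⟩))` of ★ D8: the law for `pairRep … (chiSplittingLine …)` at `(toDiagA u, 1)` -/

section Line

variable {n'' : ℕ} (e₁ : Fin (n + n) × Fin 1 ≃ Fin n'') (hdV0 : ∀ i, dV i ≠ 0) (hdW0 : ∀ i, dW i ≠ 0)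
  (lam : IdeleClassGroup L →ₜ* Circle) (hlam : IsConjugateSymplectic L lam) (a' : (Fp L)ˣ)

set_option maxHeartbeats 1000000 in -- the statement over the line-pair carriers times out at the default (measured in ★ FILE 3), as ★ p863332
/-- **THE κ-MODEL MULTIPLIER LAW OF THE LINE PAIR, ALL OF `N_Δ(𝔸)`, EVERY `Ψ`.**  For `pairRep … (chiSplittingLine … at T_W = a′)` of `(U(𝔻), U(⟨a′⟩))` (★ D8), any
`g ∈ Sp(𝕎_𝔸)` with FILE 2's membership `hj`, a lift `q` of `g`, and `u ∈ N_Δ(𝔸)` with the Levi reading `a⁻¹ = 1` of `g⁻¹ ι(u ⊗ 1) g`: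
`M_q⁻¹ (ω(toDiagA u, 1) (M_q Ψ)) = t((−½) • c_{g⁻¹ ι(u ⊗ 1) g}) Ψ`. [cite: Weil1964, Chap. I n° 13 p. 160, n° 34 p. 184] [cite: Kudla1994, §3] [cite: Liu2021, App. B Prop. B.8 p. 104] -/
theorem pairRep_line_kappaModel_eq_chirpLM
    (g : symplecticGroup (polar (adelicForm (Fp L) (Fin n'')
      (adelicGram (Fp L) e₁ (realDiagonal L (dD L e dV hdV dW hdW) (dD_conj L e dV hdV dW hdW)) (TW (Fp L) a')))))
    (q : adelicMp (Fp L) (Fin n'') (adelicGram (Fp L) e₁ (realDiagonal L (dD L e dV hdV dW hdW) (dD_conj L e dV hdV dW hdW)) (TW (Fp L) a')))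
    (hqc : q ∈ adelicMpCont (Fp L) (Fin n'') (adelicGram (Fp L) e₁ (realDiagonal L (dD L e dV hdV dW hdW) (dD_conj L e dV hdV dW hdW)) (TW (Fp L) a')))
    (hq : MpPsi.proj _ q = g)
    (hj : ∀ p : ↥(siegelDelta L e dV hdV dW hdW),
      g⁻¹ * toSp (Fp L) L (IsCMField.complexConj L) (n + n) 1 e₁ (Matrix.diagonal (dD L e dV hdV dW hdW)) (JW (Fp L) L a')
          (complexConj_imagUnit L) (imagUnit_ne_zero L) (imagUnit_mul_self L)
          (realDiagonal_isSymm L (dD L e dV hdV dW hdW) (dD_conj L e dV hdV dW hdW)) (isSymm_TW (Fp L) a')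
          (realDiagonal_map L (dD L e dV hdV dW hdW) (dD_conj L e dV hdV dW hdW)).symm (JW_eq (Fp L) L a')
          (UnitaryGroup.adelicInl (Fp L) L (IsCMField.complexConj L) (n + n) 1 (Matrix.diagonal (dD L e dV hdV dW hdW)) (JW (Fp L) L a')
            (toDiagA L e dV hdV dW hdW (p : HA L e dV hdV dW hdW))) * g ∈
        siegelParabolicPi (adelicGram (Fp L) e₁ (realDiagonal L (dD L e dV hdV dW hdW) (dD_conj L e dV hdV dW hdW)) (TW (Fp L) a')))
    {u : HA L e dV hdV dW hdW} (hu : u ∈ unipDelta L e dV hdV dW hdW)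
    (ha : SiegelParabolicPi.aInvMat (g⁻¹ *
        toSp (Fp L) L (IsCMField.complexConj L) (n + n) 1 e₁ (Matrix.diagonal (dD L e dV hdV dW hdW)) (JW (Fp L) L a')
          (complexConj_imagUnit L) (imagUnit_ne_zero L) (imagUnit_mul_self L)
          (realDiagonal_isSymm L (dD L e dV hdV dW hdW) (dD_conj L e dV hdV dW hdW)) (isSymm_TW (Fp L) a')
          (realDiagonal_map L (dD L e dV hdV dW hdW) (dD_conj L e dV hdV dW hdW)).symm (JW_eq (Fp L) L a')
          (UnitaryGroup.adelicInl (Fp L) L (IsCMField.complexConj L) (n + n) 1 (Matrix.diagonal (dD L e dV hdV dW hdW)) (JW (Fp L) L a')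
            (toDiagA L e dV hdV dW hdW u)) * g) = 1)
    {S : Matrix (Fin n'') (Fin n'') (AdeleRing (𝓞 (Fp L)) (Fp L))}
    (hS : (-⅟(2 : AdeleRing (𝓞 (Fp L)) (Fp L))) • SiegelParabolicPi.cMat (g⁻¹ *
        toSp (Fp L) L (IsCMField.complexConj L) (n + n) 1 e₁ (Matrix.diagonal (dD L e dV hdV dW hdW)) (JW (Fp L) L a')
          (complexConj_imagUnit L) (imagUnit_ne_zero L) (imagUnit_mul_self L)
          (realDiagonal_isSymm L (dD L e dV hdV dW hdW) (dD_conj L e dV hdV dW hdW)) (isSymm_TW (Fp L) a')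
          (realDiagonal_map L (dD L e dV hdV dW hdW) (dD_conj L e dV hdV dW hdW)).symm (JW_eq (Fp L) L a')
          (UnitaryGroup.adelicInl (Fp L) L (IsCMField.complexConj L) (n + n) 1 (Matrix.diagonal (dD L e dV hdV dW hdW)) (JW (Fp L) L a')
            (toDiagA L e dV hdV dW hdW u)) * g) = S)
    (Ψ : piSchwartzBruhat (Fp L) (Fin n'')) :
    (MpPsi.toOp (adelicSchrodinger (Fp L) (Fin n'')
        (adelicGram (Fp L) e₁ (realDiagonal L (dD L e dV hdV dW hdW) (dD_conj L e dV hdV dW hdW)) (TW (Fp L) a'))) q).symm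
        (pairRep (Fp L) L (IsCMField.complexConj L) (n + n) 1 e₁ (Matrix.diagonal (dD L e dV hdV dW hdW)) (JW (Fp L) L a')
          (chiSplittingLine L e₁ (dD L e dV hdV dW hdW) (dD_conj L e dV hdV dW hdW) (dD_ne_zero L e dV hdV dW hdW hdV0 hdW0)
            (toHeckeCharacter L lam) (isUnitary_toHeckeCharacter L lam)
            ((isOscillatorChar_toHeckeCharacter_iff lam).mpr hlam) (TW (Fp L) a')
            (isUnit_det_TW (Fp L) a') (JW (Fp L) L a') (JW_eq (Fp L) L a'))
          (toDiagA L e dV hdV dW hdW u, 1)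
          (MpPsi.toOp (adelicSchrodinger (Fp L) (Fin n'')
            (adelicGram (Fp L) e₁ (realDiagonal L (dD L e dV hdV dW hdW) (dD_conj L e dV hdV dW hdW)) (TW (Fp L) a'))) q Ψ)) =
      chirpLM (Fp L) S Ψ := by
  -- the line splitting composed with `h ↦ (toDiagA h, 1)`, as a homomorphism on `H(𝔸)`
  let sl : HA L e dV hdV dW hdW →* adelicMpCont (Fp L) (Fin n'')
      (adelicGram (Fp L) e₁ (realDiagonal L (dD L e dV hdV dW hdW) (dD_conj L e dV hdV dW hdW)) (TW (Fp L) a')) :=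
    (pairSplitting (Fp L) L (IsCMField.complexConj L) (n + n) 1 e₁ (Matrix.diagonal (dD L e dV hdV dW hdW)) (JW (Fp L) L a')
      (chiSplittingLine L e₁ (dD L e dV hdV dW hdW) (dD_conj L e dV hdV dW hdW) (dD_ne_zero L e dV hdV dW hdW hdV0 hdW0)
        (toHeckeCharacter L lam) (isUnitary_toHeckeCharacter L lam)
        ((isOscillatorChar_toHeckeCharacter_iff lam).mpr hlam) (TW (Fp L) a')
        (isUnit_det_TW (Fp L) a') (JW (Fp L) L a') (JW_eq (Fp L) L a'))).comp
      ((toDiagA L e dV hdV dW hdW).toMonoidHom.prod 1)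
  have hsl : ∀ h : HA L e dV hdV dW hdW, sl h =
      pairSplitting (Fp L) L (IsCMField.complexConj L) (n + n) 1 e₁ (Matrix.diagonal (dD L e dV hdV dW hdW)) (JW (Fp L) L a')
        (chiSplittingLine L e₁ (dD L e dV hdV dW hdW) (dD_conj L e dV hdV dW hdW) (dD_ne_zero L e dV hdV dW hdW hdV0 hdW0)
          (toHeckeCharacter L lam) (isUnitary_toHeckeCharacter L lam)
          ((isOscillatorChar_toHeckeCharacter_iff lam).mpr hlam) (TW (Fp L) a')
          (isUnit_det_TW (Fp L) a') (JW (Fp L) L a') (JW_eq (Fp L) L a')) (toDiagA L e dV hdV dW hdW h, 1) := fun h => rfl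
  -- its symplectic projection is `ι(toDiagA h ⊗ 1)`
  have hproj : ∀ h : HA L e dV hdV dW hdW,
      adelicMpCont.proj (Fp L) (Fin n'') (adelicGram (Fp L) e₁ (realDiagonal L (dD L e dV hdV dW hdW) (dD_conj L e dV hdV dW hdW)) (TW (Fp L) a')) (sl h) =
        toSp (Fp L) L (IsCMField.complexConj L) (n + n) 1 e₁ (Matrix.diagonal (dD L e dV hdV dW hdW)) (JW (Fp L) L a')
          (complexConj_imagUnit L) (imagUnit_ne_zero L) (imagUnit_mul_self L)
          (realDiagonal_isSymm L (dD L e dV hdV dW hdW) (dD_conj L e dV hdV dW hdW)) (isSymm_TW (Fp L) a')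
          (realDiagonal_map L (dD L e dV hdV dW hdW) (dD_conj L e dV hdV dW hdW)).symm (JW_eq (Fp L) L a')
          (UnitaryGroup.adelicInl (Fp L) L (IsCMField.complexConj L) (n + n) 1 (Matrix.diagonal (dD L e dV hdV dW hdW)) (JW (Fp L) L a')
            (toDiagA L e dV hdV dW hdW h)) :=
    fun h => (congrArg _ (hsl h)).trans (proj_pairSplitting_line L e dV hdV dW hdW e₁ hdV0 hdW0 lam hlam a' (toDiagA L e dV hdV dW hdW h))
  have hj' : ∀ p : ↥(siegelDelta L e dV hdV dW hdW),
      g⁻¹ * ((adelicMpCont.proj (Fp L) (Fin n'') (adelicGram (Fp L) e₁ (realDiagonal L (dD L e dV hdV dW hdW) (dD_conj L e dV hdV dW hdW))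
          (TW (Fp L) a'))).comp (sl.comp (siegelDelta L e dV hdV dW hdW).subtype)) p * g ∈
        siegelParabolicPi (adelicGram (Fp L) e₁ (realDiagonal L (dD L e dV hdV dW hdW) (dD_conj L e dV hdV dW hdW)) (TW (Fp L) a')) := by
    intro p
    have h := hj p
    rw [← hproj] at h
    exact h
  have ha' : SiegelParabolicPi.aInvMat (g⁻¹ *
      adelicMpCont.proj (Fp L) (Fin n'') (adelicGram (Fp L) e₁ (realDiagonal L (dD L e dV hdV dW hdW) (dD_conj L e dV hdV dW hdW)) (TW (Fp L) a'))
        (sl u) * g) = 1 := by rw [hproj]; exact ha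
  have hS' : (-⅟(2 : AdeleRing (𝓞 (Fp L)) (Fp L))) • SiegelParabolicPi.cMat (g⁻¹ *
      adelicMpCont.proj (Fp L) (Fin n'') (adelicGram (Fp L) e₁ (realDiagonal L (dD L e dV hdV dW hdW) (dD_conj L e dV hdV dW hdW)) (TW (Fp L) a'))
        (sl u) * g) = S := by rw [hproj]; exact hS
  have key := kappaModel_eq_chirpLM_of_mem_unipDelta L e dV hdV dW hdW hdV0 hdW0
    (isUnit_det_adelicGram (Fp L) e₁
      (isUnit_det_realDiagonal L (dD L e dV hdV dW hdW) (dD_conj L e dV hdV dW hdW) (dD_ne_zero L e dV hdV dW hdW hdV0 hdW0))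
      (isUnit_det_TW (Fp L) a'))
    sl g q hqc hq hj' hu ha' hS' Ψ
  rw [hsl u] at key
  exact key


/-! ## §3 At the line Cayley mover OF RECORD `κ_n` (F0P2-p10 ★ FILE 2∕2c): `g := (ratSp κ_n)⁻¹`, `q := r_F(κ_n)⁻¹`, `Tg := M_q⁻¹ = ω(r_F κ_n)` — NO letters left -/

set_option maxHeartbeats 1000000 in -- idem
/-- **THE κ-MODEL MULTIPLIER LAW AT THE LINE CAYLEY MOVER OF RECORD, ALL OF `N_Δ(𝔸)`, EVERY `Ψ`.**  With `Tg := M_{r_F(κ_n)⁻¹}⁻¹ = ω(r_F κ_n)` (the GLOBAL Cayley-mover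
model of the (B1c′) chain, ★ p863969 ∕ ★ p864051): for every `u ∈ N_Δ(𝔸)` and every READING `S` of the chirp parameter `(−½) • c_{q_u}`,
`q_u := ratSp κ_n · ι(u ⊗ 1) · (ratSp κ_n)⁻¹` (★ p863869 `aMat_cMat_lineKappa_of_mem_unipDelta`.2 is the closed-form reading B3-2c-idx keys its index map to),
`Tg (ω(toDiagA u, 1) (Tg⁻¹ Ψ)) = t(S) Ψ` — §2 with membership ★ `ratSp_lineCayleyMover_conj_toSp_mem_siegelParabolicPi` and Levi reading ★ `aMat_cMat_…`.1.
[cite: Weil1964, Chap. I n° 13 p. 160, n° 34 p. 184; Chap. III n° 40–41 pp. 190–193] [cite: Kudla1994, §3] [cite: Liu2021, App. B Prop. B.8 p. 104] -/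
theorem pairRep_line_lineCayley_eq_chirpLM {u : HA L e dV hdV dW hdW} (hu : u ∈ unipDelta L e dV hdV dW hdW)
    {S : Matrix (Fin n'') (Fin n'') (AdeleRing (𝓞 (Fp L)) (Fp L))}
    (hS : (-⅟(2 : AdeleRing (𝓞 (Fp L)) (Fp L))) • SiegelParabolicPi.cMat (ratSp (Fp L) (adelicGram (Fp L) e₁ (realDiagonal L (dD L e dV hdV dW hdW) (dD_conj L e dV hdV dW hdW)) (TW (Fp L) a'))
          (isUnit_det_adelicGram (Fp L) e₁
            (isUnit_det_realDiagonal L (dD L e dV hdV dW hdW) (dD_conj L e dV hdV dW hdW) (dD_ne_zero L e dV hdV dW hdW hdV0 hdW0))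
            (isUnit_det_TW (Fp L) a')) (⟨_, lineCayleyMover_mem_symplecticGroup (Fp L) n ((Equiv.prodUnique (Fin (n + n)) (Fin 1)).symm.trans e₁) (Units.mul_inv a')⟩ : Matrix.symplecticGroup (Fin n'') (Fp L)) *
        toSp (Fp L) L (IsCMField.complexConj L) (n + n) 1 e₁ (Matrix.diagonal (dD L e dV hdV dW hdW)) (JW (Fp L) L a')
          (complexConj_imagUnit L) (imagUnit_ne_zero L) (imagUnit_mul_self L)
          (realDiagonal_isSymm L (dD L e dV hdV dW hdW) (dD_conj L e dV hdV dW hdW)) (isSymm_TW (Fp L) a')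
          (realDiagonal_map L (dD L e dV hdV dW hdW) (dD_conj L e dV hdV dW hdW)).symm (JW_eq (Fp L) L a')
          (UnitaryGroup.adelicInl (Fp L) L (IsCMField.complexConj L) (n + n) 1 (Matrix.diagonal (dD L e dV hdV dW hdW)) (JW (Fp L) L a')
            (toDiagA L e dV hdV dW hdW u)) *
        (ratSp (Fp L) (adelicGram (Fp L) e₁ (realDiagonal L (dD L e dV hdV dW hdW) (dD_conj L e dV hdV dW hdW)) (TW (Fp L) a'))
          (isUnit_det_adelicGram (Fp L) e₁
            (isUnit_det_realDiagonal L (dD L e dV hdV dW hdW) (dD_conj L e dV hdV dW hdW) (dD_ne_zero L e dV hdV dW hdW hdV0 hdW0))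
            (isUnit_det_TW (Fp L) a')) (⟨_, lineCayleyMover_mem_symplecticGroup (Fp L) n ((Equiv.prodUnique (Fin (n + n)) (Fin 1)).symm.trans e₁) (Units.mul_inv a')⟩ : Matrix.symplecticGroup (Fin n'') (Fp L)))⁻¹) = S)
    (Ψ : piSchwartzBruhat (Fp L) (Fin n'')) :
    (MpPsi.toOp (adelicSchrodinger (Fp L) (Fin n'') (adelicGram (Fp L) e₁ (realDiagonal L (dD L e dV hdV dW hdW) (dD_conj L e dV hdV dW hdW)) (TW (Fp L) a')))
      ((((ratThetaLiftCont (Fp L) (adelicGram (Fp L) e₁ (realDiagonal L (dD L e dV hdV dW hdW) (dD_conj L e dV hdV dW hdW)) (TW (Fp L) a'))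
        (isUnit_det_adelicGram (Fp L) e₁
            (isUnit_det_realDiagonal L (dD L e dV hdV dW hdW) (dD_conj L e dV hdV dW hdW) (dD_ne_zero L e dV hdV dW hdW hdV0 hdW0))
            (isUnit_det_TW (Fp L) a')) (⟨_, lineCayleyMover_mem_symplecticGroup (Fp L) n ((Equiv.prodUnique (Fin (n + n)) (Fin 1)).symm.trans e₁) (Units.mul_inv a')⟩ : Matrix.symplecticGroup (Fin n'') (Fp L)))⁻¹ :
        adelicMpCont (Fp L) (Fin n'') (adelicGram (Fp L) e₁ (realDiagonal L (dD L e dV hdV dW hdW) (dD_conj L e dV hdV dW hdW)) (TW (Fp L) a'))) :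
        adelicMp (Fp L) (Fin n'') (adelicGram (Fp L) e₁ (realDiagonal L (dD L e dV hdV dW hdW) (dD_conj L e dV hdV dW hdW)) (TW (Fp L) a'))))).symm
        (pairRep (Fp L) L (IsCMField.complexConj L) (n + n) 1 e₁ (Matrix.diagonal (dD L e dV hdV dW hdW)) (JW (Fp L) L a')
          (chiSplittingLine L e₁ (dD L e dV hdV dW hdW) (dD_conj L e dV hdV dW hdW) (dD_ne_zero L e dV hdV dW hdW hdV0 hdW0)
            (toHeckeCharacter L lam) (isUnitary_toHeckeCharacter L lam)
            ((isOscillatorChar_toHeckeCharacter_iff lam).mpr hlam) (TW (Fp L) a')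
            (isUnit_det_TW (Fp L) a') (JW (Fp L) L a') (JW_eq (Fp L) L a'))
          (toDiagA L e dV hdV dW hdW u, 1)
          ((MpPsi.toOp (adelicSchrodinger (Fp L) (Fin n'') (adelicGram (Fp L) e₁ (realDiagonal L (dD L e dV hdV dW hdW) (dD_conj L e dV hdV dW hdW)) (TW (Fp L) a')))
          ((((ratThetaLiftCont (Fp L) (adelicGram (Fp L) e₁ (realDiagonal L (dD L e dV hdV dW hdW) (dD_conj L e dV hdV dW hdW)) (TW (Fp L) a'))
        (isUnit_det_adelicGram (Fp L) e₁
            (isUnit_det_realDiagonal L (dD L e dV hdV dW hdW) (dD_conj L e dV hdV dW hdW) (dD_ne_zero L e dV hdV dW hdW hdV0 hdW0))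
            (isUnit_det_TW (Fp L) a')) (⟨_, lineCayleyMover_mem_symplecticGroup (Fp L) n ((Equiv.prodUnique (Fin (n + n)) (Fin 1)).symm.trans e₁) (Units.mul_inv a')⟩ : Matrix.symplecticGroup (Fin n'') (Fp L)))⁻¹ :
        adelicMpCont (Fp L) (Fin n'') (adelicGram (Fp L) e₁ (realDiagonal L (dD L e dV hdV dW hdW) (dD_conj L e dV hdV dW hdW)) (TW (Fp L) a'))) :
        adelicMp (Fp L) (Fin n'') (adelicGram (Fp L) e₁ (realDiagonal L (dD L e dV hdV dW hdW) (dD_conj L e dV hdV dW hdW)) (TW (Fp L) a'))))) Ψ)) =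
      chirpLM (Fp L) S Ψ := by
  -- `g := (ratSp κ_n)⁻¹`: `g⁻¹ · x · g = ratSp κ_n · x · (ratSp κ_n)⁻¹`
  have hg : ∀ x : symplecticGroup (polar (adelicForm (Fp L) (Fin n'') (adelicGram (Fp L) e₁ (realDiagonal L (dD L e dV hdV dW hdW) (dD_conj L e dV hdV dW hdW)) (TW (Fp L) a')))),
      ((ratSp (Fp L) (adelicGram (Fp L) e₁ (realDiagonal L (dD L e dV hdV dW hdW) (dD_conj L e dV hdV dW hdW)) (TW (Fp L) a'))
          (isUnit_det_adelicGram (Fp L) e₁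
            (isUnit_det_realDiagonal L (dD L e dV hdV dW hdW) (dD_conj L e dV hdV dW hdW) (dD_ne_zero L e dV hdV dW hdW hdV0 hdW0))
            (isUnit_det_TW (Fp L) a')) (⟨_, lineCayleyMover_mem_symplecticGroup (Fp L) n ((Equiv.prodUnique (Fin (n + n)) (Fin 1)).symm.trans e₁) (Units.mul_inv a')⟩ : Matrix.symplecticGroup (Fin n'') (Fp L)))⁻¹)⁻¹ * x * (ratSp (Fp L) (adelicGram (Fp L) e₁ (realDiagonal L (dD L e dV hdV dW hdW) (dD_conj L e dV hdV dW hdW)) (TW (Fp L) a'))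
          (isUnit_det_adelicGram (Fp L) e₁
            (isUnit_det_realDiagonal L (dD L e dV hdV dW hdW) (dD_conj L e dV hdV dW hdW) (dD_ne_zero L e dV hdV dW hdW hdV0 hdW0))
            (isUnit_det_TW (Fp L) a')) (⟨_, lineCayleyMover_mem_symplecticGroup (Fp L) n ((Equiv.prodUnique (Fin (n + n)) (Fin 1)).symm.trans e₁) (Units.mul_inv a')⟩ : Matrix.symplecticGroup (Fin n'') (Fp L)))⁻¹ = ratSp (Fp L) (adelicGram (Fp L) e₁ (realDiagonal L (dD L e dV hdV dW hdW) (dD_conj L e dV hdV dW hdW)) (TW (Fp L) a'))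
          (isUnit_det_adelicGram (Fp L) e₁
            (isUnit_det_realDiagonal L (dD L e dV hdV dW hdW) (dD_conj L e dV hdV dW hdW) (dD_ne_zero L e dV hdV dW hdW hdV0 hdW0))
            (isUnit_det_TW (Fp L) a')) (⟨_, lineCayleyMover_mem_symplecticGroup (Fp L) n ((Equiv.prodUnique (Fin (n + n)) (Fin 1)).symm.trans e₁) (Units.mul_inv a')⟩ : Matrix.symplecticGroup (Fin n'') (Fp L)) * x * (ratSp (Fp L) (adelicGram (Fp L) e₁ (realDiagonal L (dD L e dV hdV dW hdW) (dD_conj L e dV hdV dW hdW)) (TW (Fp L) a'))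
          (isUnit_det_adelicGram (Fp L) e₁
            (isUnit_det_realDiagonal L (dD L e dV hdV dW hdW) (dD_conj L e dV hdV dW hdW) (dD_ne_zero L e dV hdV dW hdW hdV0 hdW0))
            (isUnit_det_TW (Fp L) a')) (⟨_, lineCayleyMover_mem_symplecticGroup (Fp L) n ((Equiv.prodUnique (Fin (n + n)) (Fin 1)).symm.trans e₁) (Units.mul_inv a')⟩ : Matrix.symplecticGroup (Fin n'') (Fp L)))⁻¹ := fun x => by rw [inv_inv]
  have hq : MpPsi.proj _ ((((ratThetaLiftCont (Fp L) (adelicGram (Fp L) e₁ (realDiagonal L (dD L e dV hdV dW hdW) (dD_conj L e dV hdV dW hdW)) (TW (Fp L) a'))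
        (isUnit_det_adelicGram (Fp L) e₁
            (isUnit_det_realDiagonal L (dD L e dV hdV dW hdW) (dD_conj L e dV hdV dW hdW) (dD_ne_zero L e dV hdV dW hdW hdV0 hdW0))
            (isUnit_det_TW (Fp L) a')) (⟨_, lineCayleyMover_mem_symplecticGroup (Fp L) n ((Equiv.prodUnique (Fin (n + n)) (Fin 1)).symm.trans e₁) (Units.mul_inv a')⟩ : Matrix.symplecticGroup (Fin n'') (Fp L)))⁻¹ :
        adelicMpCont (Fp L) (Fin n'') (adelicGram (Fp L) e₁ (realDiagonal L (dD L e dV hdV dW hdW) (dD_conj L e dV hdV dW hdW)) (TW (Fp L) a'))) :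
        adelicMp (Fp L) (Fin n'') (adelicGram (Fp L) e₁ (realDiagonal L (dD L e dV hdV dW hdW) (dD_conj L e dV hdV dW hdW)) (TW (Fp L) a')))) = (ratSp (Fp L) (adelicGram (Fp L) e₁ (realDiagonal L (dD L e dV hdV dW hdW) (dD_conj L e dV hdV dW hdW)) (TW (Fp L) a'))
          (isUnit_det_adelicGram (Fp L) e₁
            (isUnit_det_realDiagonal L (dD L e dV hdV dW hdW) (dD_conj L e dV hdV dW hdW) (dD_ne_zero L e dV hdV dW hdW hdV0 hdW0))
            (isUnit_det_TW (Fp L) a')) (⟨_, lineCayleyMover_mem_symplecticGroup (Fp L) n ((Equiv.prodUnique (Fin (n + n)) (Fin 1)).symm.trans e₁) (Units.mul_inv a')⟩ : Matrix.symplecticGroup (Fin n'') (Fp L)))⁻¹ := by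
    rw [← adelicMpCont.proj_apply, map_inv, proj_ratThetaLiftCont]
  refine pairRep_line_kappaModel_eq_chirpLM L e dV hdV dW hdW e₁ hdV0 hdW0 lam hlam a' _ _ (SetLike.coe_mem _) hq (fun p => ?_) hu ?_ ?_ Ψ
  · rw [hg]
    exact ratSp_lineCayleyMover_conj_toSp_mem_siegelParabolicPi L e dV hdV hdV0 dW hdW hdW0 e₁ a' (isUnit_det_adelicGram (Fp L) e₁
            (isUnit_det_realDiagonal L (dD L e dV hdV dW hdW) (dD_conj L e dV hdV dW hdW) (dD_ne_zero L e dV hdV dW hdW hdV0 hdW0))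
            (isUnit_det_TW (Fp L) a'))
      (JW (Fp L) L a') (realDiagonal_isSymm L (dD L e dV hdV dW hdW) (dD_conj L e dV hdV dW hdW)) (isSymm_TW (Fp L) a')
      (realDiagonal_map L (dD L e dV hdV dW hdW) (dD_conj L e dV hdV dW hdW)).symm (JW_eq (Fp L) L a') p.2
  · rw [hg]
    exact aInvMat_eq_one_of_aMat_eq_one
      (ratSp_lineCayleyMover_conj_toSp_mem_siegelParabolicPi L e dV hdV hdV0 dW hdW hdW0 e₁ a' (isUnit_det_adelicGram (Fp L) e₁
            (isUnit_det_realDiagonal L (dD L e dV hdV dW hdW) (dD_conj L e dV hdV dW hdW) (dD_ne_zero L e dV hdV dW hdW hdV0 hdW0))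
            (isUnit_det_TW (Fp L) a'))
        (JW (Fp L) L a') (realDiagonal_isSymm L (dD L e dV hdV dW hdW) (dD_conj L e dV hdV dW hdW)) (isSymm_TW (Fp L) a')
        (realDiagonal_map L (dD L e dV hdV dW hdW) (dD_conj L e dV hdV dW hdW)).symm (JW_eq (Fp L) L a')
        (unipDelta_le_siegelDelta L e dV hdV dW hdW hu))
      (aMat_cMat_lineKappa_of_mem_unipDelta L e dV hdV hdV0 dW hdW hdW0 e₁ a' (isUnit_det_adelicGram (Fp L) e₁
            (isUnit_det_realDiagonal L (dD L e dV hdV dW hdW) (dD_conj L e dV hdV dW hdW) (dD_ne_zero L e dV hdV dW hdW hdV0 hdW0))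
            (isUnit_det_TW (Fp L) a'))
        (JW (Fp L) L a') (realDiagonal_isSymm L (dD L e dV hdV dW hdW) (dD_conj L e dV hdV dW hdW)) (isSymm_TW (Fp L) a')
        (realDiagonal_map L (dD L e dV hdV dW hdW) (dD_conj L e dV hdV dW hdW)).symm (JW_eq (Fp L) L a') hu).1
  · rw [hg]
    exact hS

set_option maxHeartbeats 1000000 in -- idem (the line-pair carrier types)
/-- **`Tg = ω(r_F κ_n)` FIXES `Θ`** (B3-2b's `hΘ` BY NAME): `Θ (Tg Ψ) = Θ Ψ` — `M_{r_F(κ_n)⁻¹}⁻¹ = M_{r_F(κ_n)}` (`toOp` is a homomorphism into `GL(𝒮)`, `⁻¹ = symm`) and ★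
`thetaDist_omega_ratThetaLiftCont` (Weil: `r_F` is the Θ-fixing lift). [cite: Weil1964, Chap. III n° 41 Thm 6 p. 193] [cite: GelbartRogawski1991, §3.1 p. 454] -/
theorem thetaDist_lineCayleyTg (Ψ : piSchwartzBruhat (Fp L) (Fin n'')) :
    thetaDist (Fp L) (Fin n'') (((MpPsi.toOp (adelicSchrodinger (Fp L) (Fin n'') (adelicGram (Fp L) e₁ (realDiagonal L (dD L e dV hdV dW hdW) (dD_conj L e dV hdV dW hdW)) (TW (Fp L) a')))
      ((((ratThetaLiftCont (Fp L) (adelicGram (Fp L) e₁ (realDiagonal L (dD L e dV hdV dW hdW) (dD_conj L e dV hdV dW hdW)) (TW (Fp L) a'))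
        (isUnit_det_adelicGram (Fp L) e₁
            (isUnit_det_realDiagonal L (dD L e dV hdV dW hdW) (dD_conj L e dV hdV dW hdW) (dD_ne_zero L e dV hdV dW hdW hdV0 hdW0))
            (isUnit_det_TW (Fp L) a')) (⟨_, lineCayleyMover_mem_symplecticGroup (Fp L) n ((Equiv.prodUnique (Fin (n + n)) (Fin 1)).symm.trans e₁) (Units.mul_inv a')⟩ : Matrix.symplecticGroup (Fin n'') (Fp L)))⁻¹ :
        adelicMpCont (Fp L) (Fin n'') (adelicGram (Fp L) e₁ (realDiagonal L (dD L e dV hdV dW hdW) (dD_conj L e dV hdV dW hdW)) (TW (Fp L) a'))) :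
        adelicMp (Fp L) (Fin n'') (adelicGram (Fp L) e₁ (realDiagonal L (dD L e dV hdV dW hdW) (dD_conj L e dV hdV dW hdW)) (TW (Fp L) a'))))).symm Ψ : piSchwartzBruhat (Fp L) (Fin n'')) : (Fin n'' → AdeleRing (𝓞 (Fp L)) (Fp L)) → ℂ) =
      thetaDist (Fp L) (Fin n'') (Ψ : (Fin n'' → AdeleRing (𝓞 (Fp L)) (Fp L)) → ℂ) := by
  have hTgΨ : (MpPsi.toOp (adelicSchrodinger (Fp L) (Fin n'') (adelicGram (Fp L) e₁ (realDiagonal L (dD L e dV hdV dW hdW) (dD_conj L e dV hdV dW hdW)) (TW (Fp L) a')))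
      ((((ratThetaLiftCont (Fp L) (adelicGram (Fp L) e₁ (realDiagonal L (dD L e dV hdV dW hdW) (dD_conj L e dV hdV dW hdW)) (TW (Fp L) a'))
        (isUnit_det_adelicGram (Fp L) e₁
            (isUnit_det_realDiagonal L (dD L e dV hdV dW hdW) (dD_conj L e dV hdV dW hdW) (dD_ne_zero L e dV hdV dW hdW hdV0 hdW0))
            (isUnit_det_TW (Fp L) a')) (⟨_, lineCayleyMover_mem_symplecticGroup (Fp L) n ((Equiv.prodUnique (Fin (n + n)) (Fin 1)).symm.trans e₁) (Units.mul_inv a')⟩ : Matrix.symplecticGroup (Fin n'') (Fp L)))⁻¹ :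
        adelicMpCont (Fp L) (Fin n'') (adelicGram (Fp L) e₁ (realDiagonal L (dD L e dV hdV dW hdW) (dD_conj L e dV hdV dW hdW)) (TW (Fp L) a'))) :
        adelicMp (Fp L) (Fin n'') (adelicGram (Fp L) e₁ (realDiagonal L (dD L e dV hdV dW hdW) (dD_conj L e dV hdV dW hdW)) (TW (Fp L) a'))))).symm Ψ =
      MpPsi.toOp (adelicSchrodinger (Fp L) (Fin n'') (adelicGram (Fp L) e₁ (realDiagonal L (dD L e dV hdV dW hdW) (dD_conj L e dV hdV dW hdW)) (TW (Fp L) a')))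
        ((ratThetaLiftCont (Fp L) (adelicGram (Fp L) e₁ (realDiagonal L (dD L e dV hdV dW hdW) (dD_conj L e dV hdV dW hdW)) (TW (Fp L) a'))
          (isUnit_det_adelicGram (Fp L) e₁
            (isUnit_det_realDiagonal L (dD L e dV hdV dW hdW) (dD_conj L e dV hdV dW hdW) (dD_ne_zero L e dV hdV dW hdW hdV0 hdW0))
            (isUnit_det_TW (Fp L) a')) (⟨_, lineCayleyMover_mem_symplecticGroup (Fp L) n ((Equiv.prodUnique (Fin (n + n)) (Fin 1)).symm.trans e₁) (Units.mul_inv a')⟩ : Matrix.symplecticGroup (Fin n'') (Fp L)) :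
          adelicMpCont (Fp L) (Fin n'') (adelicGram (Fp L) e₁ (realDiagonal L (dD L e dV hdV dW hdW) (dD_conj L e dV hdV dW hdW)) (TW (Fp L) a'))) : adelicMp (Fp L) (Fin n'') (adelicGram (Fp L) e₁ (realDiagonal L (dD L e dV hdV dW hdW) (dD_conj L e dV hdV dW hdW)) (TW (Fp L) a'))) Ψ := by
    rw [LinearEquiv.symm_apply_eq, ← LinearEquiv.mul_apply, ← map_mul, Subgroup.coe_inv, inv_mul_cancel, map_one, LinearEquiv.coe_one]
    rfl
  rw [hTgΨ]
  exact thetaDist_omega_ratThetaLiftCont (Fp L) (adelicGram (Fp L) e₁ (realDiagonal L (dD L e dV hdV dW hdW) (dD_conj L e dV hdV dW hdW)) (TW (Fp L) a')) (isUnit_det_adelicGram (Fp L) e₁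
            (isUnit_det_realDiagonal L (dD L e dV hdV dW hdW) (dD_conj L e dV hdV dW hdW) (dD_ne_zero L e dV hdV dW hdW hdV0 hdW0))
            (isUnit_det_TW (Fp L) a')) (⟨_, lineCayleyMover_mem_symplecticGroup (Fp L) n ((Equiv.prodUnique (Fin (n + n)) (Fin 1)).symm.trans e₁) (Units.mul_inv a')⟩ : Matrix.symplecticGroup (Fin n'') (Fp L)) Ψ

end Line

end Summit.HodgeConjecture.HodgeConjecture.Cruxes.HLiu418.K2LiuLinePairKappaModelChirpGlobal

end
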